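import Literature.AlgebraicGeometry.HodgeTheory.BettiHodgeConjectureProductsSmallChowGroups
import Literature.AlgebraicGeometry.Motives.CubicEightfoldChowTwo
import HarnessLib

/-!
# The Hodge conjecture for complete intersections of VERY SMALL DEGREE from their small Chow groups, over `ℂ` and WITHOUT a base-change bridge: every smooth cubic hypersurface of dimension `≤ 7`
# (in particular every smooth CUBIC SIXFOLD `X ⊂ ℙ⁷_ℂ`), `(2,2)` up to dimension `7`, `(2,2,2)` up to dimension `9` except `8`, granted Esnault–Levine–Viehweg; cubic eightfolds granted ELV +
# Hirschowitz–Iyer; and their products (Vial 2013 Thm. 7.1 (i) and §7.2.2–7.2.3; Laterveer 1998; ELV 1997 Thm. 4.6; Otwinowska 1999; Hirschowitz–Iyer 2010 Thm. 1.5; Voisin 2013 Lemma 2.1)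

Family `hodge`, lane `lit-hodgefound` (Track 2 foundations library; Layers A1/A4), layer `Literature/AlgebraicGeometry/HodgeTheory`.  THEOREMS ONLY (no definition, no NEW named fact, no instance;
D-0026 net debt `0`); the non-proved inputs are the tree's EXISTING named facts `Motives.EsnaultLevineViehweg1997_chowGroup_rank_le_one` (hypothesis `hR`, as in
`HodgeConjectureProductsCubicFivefoldsOfELV`) and, for eightfolds only, `Motives.HirschowitzIyer2010_chowTwo_rank_le_one_cubicEightfold` (hypothesis `h`, as in `CubicEightfoldHodgeConjectureOfChowGroups`).
Sequel of the seat's g33-#7 (`BettiHodgeConjectureProductsSmallChowGroups`: the CYCLE-LEVEL Laterveer / Vial theorem `hodgeConjectureFor_of_chowRankLEOneUpTo` — `Motives.ChowRankLEOneUpTo X k₀` over `ℂ`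
itself and `dim X ≤ 2k₀ + 5` give `HC(X)` — and the product theorems `hodgeConjectureFor_tensor_of_chowRankLEOneUpTo`, `…_of_dim_le_three`).

WHY A NEW FILE.  The tree's two «HC of Chow groups» assemblies `CubicEightfoldHodgeConjectureOfChowGroups` and `QuadricCompleteIntersectionHodgeConjecture` run through
`Vial2013_hodgeConjectureFor_of_chowGroups_rank_le_one_holds`, whose hypothesis is on the Chow groups of ALL base changes `X_L`, and therefore carry an explicit base-change bridge `hbc`
(«`X_L` is again a smooth complete intersection of the same multidegree», absent from the tree) and, for quadrics, `c ≤ dim X`.  Through the cycle-level theorem both hypotheses DISAPPEAR: the Chow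
input is needed over `ℂ` only, where the typed ELV fact applies to `X` itself.  The audit `Barriers/HodgeConjecture/NormalFunctions` records that NO printed source draws the conclusion `HC` for cubic
sixfolds; it is PRINT-IMPLIED at distance zero — Vial 2013 Thm. 7.1, first item (`d = 6`, `l = ⌊(6−4)/2⌋ = 1`, niveau `0 ≤ 3`: «then `X` satisfies the Hodge conjecture»), with Vial 2013 §7.2.2
(«Let `X ⊂ ℙⁿ` be a cubic hypersurface. Then `CH₁(X) = ℚ` for `dim X ≥ 5`», i.e. ELV Thm. 4.6 at `l = 1`: `C(4,2) = 6 ≤ n`) — and is assembled here as a theorem granted the typed ELV fact, never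
vendored as a fact of its own (exactly the status of the tree's cubic-eightfold assembly).

THE ARGUMENT.  ELV Thm. 4.6 (typed): a smooth complete intersection `X ⊂ ℙ^{m+c}` of multidegree `d` (`d a ≥ 2`; `∃ d a ≥ 3` or `l + 1 ≤ c`) with `Σ_a C(l + d a, l + 1) ≤ m + c` has `CH_{l'}(X) ⊗ ℚ` of
rank `≤ 1` for `l' ≤ l`, i.e. `Motives.ChowRankLEOneUpTo X l` (`Motives.chowRankLEOneUpTo_iff_chowGroup`); then g33-#7 §1 gives `HC(X)` for `m ≤ 2l + 5` and g33-#7 §3 gives `HC(X × Z)`.  Cubics: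
`l = 1` needs `6 ≤ m + 1`, `l = 0` needs `3 ≤ m + 1`; so `HC` for `m ≤ 7` (`m ≤ 3` is the tree's `hodgeConjectureFor_of_dim_le_three_holds`).  `(2,2)`: `l = 1` (`l + 1 ≤ 2`) needs `6 ≤ m + 2`.
`(2,2,2)`: `l = 0, 1, 2` need `6 ≤ m + 3`, `9 ≤ m + 3`, `12 ≤ m + 3`, whence `m ≤ 5`, `m ≤ 7`, `m = 9` (`m = 8` would need `CH₂`, beyond ELV: Otwinowska — the tree's quadric file, with its bridge).
Cubic eightfolds: `CH₀, CH₁` by ELV, `CH₂` by Hirschowitz–Iyer / Otwinowska (the tree's `Motives.chowGroup_rank_le_one_of_le_two_cubicEightfold`), `8 ≤ 2·2 + 5`.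

WHAT IS PROVED (`0` sorrys; every statement a theorem).
* §1 `chowRankLEOneUpTo_of_isSmoothCompleteIntersection_of_ELV`, `hodgeConjectureFor_completeIntersection_of_ELV` (general multidegree: ELV range + `dim ≤ 2l + 5` ⟹ `HC`),
  `hodgeConjectureFor_tensor_completeIntersections_of_ELV`, `hodgeConjectureFor_completeIntersection_tensor_of_dim_le_three_of_ELV` (products, from g33-#7 §3).
* §2 Cubics: `chowRankLEOneUpTo_one_of_cubic_of_ELV` (`dim ≥ 5`), **`hodgeConjectureFor_cubic_of_ELV`** (every smooth cubic hypersurface of dimension `≤ 7`), the named instances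
  `hodgeConjectureFor_cubicFivefold_of_ELV`, **`hodgeConjectureFor_cubicSixfold_of_ELV`**, `hodgeConjectureFor_cubicSevenfold_of_ELV`; bridge-free cubic eightfolds `hodgeConjectureFor_cubicEightfoldCI_of_chow'`
  (the tree's Chow binder `hCH`, no `hbc`) and `hodgeConjectureFor_cubicEightfoldCI_of_hirschowitzIyer_of_ELV` (the two typed facts, nothing else).
* §3 Quadrics: `hodgeConjectureFor_twoQuadrics_of_ELV` (`dim ≤ 7`), `hodgeConjectureFor_threeQuadrics_of_ELV` (`dim ≤ 9`, `dim ≠ 8`); bridge-free Otwinowska form `hodgeConjectureFor_ciQuadrics_of_chow'`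
  (`c ≤ 4`, every dimension, the tree's Chow binder `hCH`, no `hbc`, no `c ≤ dim X`).
* §4 Products granted ELV: `HC(X₆ × C)` for a cubic sixfold and every curve; `HC(X₆ × T)` for `CH₀(T)` of rank `≤ 1`; `HC(X₆ × X₅)` for a cubic sixfold and a fivefold with `CH₀, CH₁` of rank `≤ 1`, in
  particular a cubic sixfold times a cubic fivefold; `HC(Y × T)` for a `(2,2)` fourfold and EVERY threefold; `HC(Y × S)` for a `(2,2)` fivefold and every surface.

THE PRINTS.  Ch. Vial (2013) [Vial2013] Thm. 7.1 first item and its proof p. 19, §7.2.2 (cubics: `CH₀ = ℚ` for `dim ≥ 2`, `CH₁ = ℚ` for `dim ≥ 5`, `CH₂ = ℚ` for `dim ≥ 8` after Otwinowska), §7.2.3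
(`(2,2)`: `CH₁ = ℚ` for `dim ≥ 4`); R. Laterveer (1998) [Laterveer1998] main theorem; H. Esnault, M. Levine, E. Viehweg (1997) [EsnaultLevineViehweg1997] Thm. 4.6; A. Hirschowitz, J. Iyer (2010)
[HirschowitzIyer2010] Thm. 1.5; A. Otwinowska (1999) [Otwinowska1999] Théorème; [Otwinowska1999b] Théorème (1); C. Voisin (2003) [VoisinHodgeII2003] Thm. 10.29, Thm. 10.31; C. Voisin (2013)
[Voisin2013GHCBloch] Lemma 2.1 (proof); C. Voisin (2002) [VoisinHodgeI2002] §11.3.3.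

THE OBJECTS (all the tree's).  `Motives.IsSmoothCompleteIntersection`, `Motives.ChowRankLEOneUpTo`, `Motives.ChowGroup`, `Motives.EsnaultLevineViehweg1997_chowGroup_rank_le_one`,
`Motives.HirschowitzIyer2010_chowTwo_rank_le_one_cubicEightfold`, `Motives.chowGroup_rank_le_one_of_le_two_cubicEightfold`, `Motives.chowRankLEOneUpTo_iff_chowGroup`, `HodgeConjectureFor`; the seat's
`hodgeConjectureFor_of_chowRankLEOneUpTo`, `hodgeConjectureFor_tensor_of_chowRankLEOneUpTo`, `hodgeConjectureFor_tensor_of_chowRankLEOneUpTo_of_dim_le_three`, `hodgeConjectureFor_of_dim_le_three_holds`.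

DEVIATIONS / SCOPE.  Conditional on the typed ELV fact (a refereed theorem whose proof is not in the tree), as its predecessors; §2's eightfold on Hirschowitz–Iyer as well.  Varieties are given as
`Motives.IsSmoothCompleteIntersection m d X` (cut out by a nonsingular system — the spelling of the Chow facts); the passage from `Motives.IsSmoothHypersurface m 3 X` needs a nonsingular defining form
(`isSmoothCompleteIntersection_of_isHypersurfaceCutOutBy_of_isNonsingularForm`) and is not repeated.  For `dim ≤ 4` cubics / fourfolds and fivefolds with `CH₀ = ℤ` the tree already has UNCONDITIONAL
theorems (`hodgeConjectureFor_cubicFourfold_holds`, `hodgeConjectureFor_four/five_of_hasChowZeroSupportedInDimLE`); the uniform statements below are granted ELV throughout.  Vial's Thm. 7.1 allows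
Chow groups of NIVEAU `≤ 3`; only niveau `0` (rank `≤ 1`) is typed in the tree.

## References
* [Vial2013] Ch. Vial, *Algebraic cycles and fibrations*, Doc. Math. 18 (2013) — Thm. 7.1 (first item) and proof p. 19; §7.2.2; §7.2.3; Prop. 7.5–7.6.
* [Laterveer1998] R. Laterveer, *Algebraic varieties with small Chow groups*, J. Math. Kyoto Univ. 38 (1998) — main theorem.
* [EsnaultLevineViehweg1997] H. Esnault, M. Levine, E. Viehweg, Duke Math. J. 87 (1997) — Thm. 4.6 (announced as Thm. 4.5 in the Introduction), first bullet.
* [HirschowitzIyer2010] A. Hirschowitz, J. N. N. Iyer, Contemp. Math. 522 (2010) — Thm. 1.5 at `(9, 2, 1, (3))`, §1.7.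
* [Otwinowska1999] A. Otwinowska, C. R. Acad. Sci. Paris 329 (1999) 51–56 — Théorème.
* [Otwinowska1999b] A. Otwinowska, C. R. Acad. Sci. Paris 329 (1999) 141–146 — Théorème (1).
* [VoisinHodgeII2003] C. Voisin, *Hodge Theory and Complex Algebraic Geometry II* — Thm. 10.29, Thm. 10.31.
* [Voisin2013GHCBloch] C. Voisin, Ann. Sci. ÉNS 46 (2013) — Lemma 2.1 (proof).
* [VoisinHodgeI2002] C. Voisin, *Hodge Theory and Complex Algebraic Geometry I* — §11.3.3 Thm. 11.38, Lemma 11.41, p. 287.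

## Provenance
Lane `lit-hodgefound` (summit `HodgeConjecture`, Track 2 foundations), seat `lit-hodgefound-p29` (literature-prover, generation 33, row g33-#8).
-/

noncomputable section

open CategoryTheory AlgebraicGeometry MonoidalCategory Finset

namespace Literature.AlgebraicGeometry.HodgeTheory

open Literature.AlgebraicGeometry.Motives

variable {m n c c' : ℕ} {d : Fin c → ℕ} {d' : Fin c' → ℕ} {X Y Z C S T : SchemeOver ℂ}

/-! ### §1 ELV range ⟹ small Chow groups ⟹ `HC`, any multidegree -/

/-- **Esnault–Levine–Viehweg in the tree's cycle-level spelling**: a smooth complete intersection `X ⊂ ℙ^{m+c}_ℂ` of multidegree `d` (`d a ≥ 2`, and `∃ d a ≥ 3` or `l + 1 ≤ c`) with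
`Σ_a C(l + d a, l + 1) ≤ m + c` has `CH₀(X)_ℚ, …, CH_l(X)_ℚ` of rank `≤ 1` (`Motives.ChowRankLEOneUpTo X l`), granted the typed fact. [cite: EsnaultLevineViehweg1997, Thm 4.6 (announced as Thm 4.5 in the Introduction), first bullet]
[cite: Vial2013, §7.2.2–7.2.3] -/
theorem chowRankLEOneUpTo_of_isSmoothCompleteIntersection_of_ELV (hR : EsnaultLevineViehweg1997_chowGroup_rank_le_one.{0}) (hX : IsSmoothCompleteIntersection m d X)
    (hd : ∀ a, 2 ≤ d a) {l : ℕ} (hl : (∃ a, 3 ≤ d a) ∨ l + 1 ≤ c) (hsum : ∑ a, Nat.choose (l + d a) (l + 1) ≤ m + c) : ChowRankLEOneUpTo X l :=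
  (chowRankLEOneUpTo_iff_chowGroup X l).2 fun _ hj a b ↦ hR hX hd hl hsum hj a b

/-- **`HC(X)` for a smooth complete intersection in the ELV range `Σ_a C(l + d a, l + 1) ≤ m + c` of dimension `m ≤ 2l + 5`, granted ELV** (Laterveer / Vial 2013 Thm. 7.1 first item, cycle-level,
over `ℂ`; no base-change bridge). [cite: Vial2013, Thm 7.1 (first item) and §7.2] [cite: Laterveer1998, main theorem (as quoted in Vial2013 Thm. 7.1)]
[cite: EsnaultLevineViehweg1997, Thm 4.6 (announced as Thm 4.5 in the Introduction), first bullet] -/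
theorem hodgeConjectureFor_completeIntersection_of_ELV (hR : EsnaultLevineViehweg1997_chowGroup_rank_le_one.{0}) (hX : IsSmoothCompleteIntersection m d X) (hd : ∀ a, 2 ≤ d a)
    {l : ℕ} (hl : (∃ a, 3 ≤ d a) ∨ l + 1 ≤ c) (hsum : ∑ a, Nat.choose (l + d a) (l + 1) ≤ m + c) (hm : m ≤ 2 * l + 5) : HodgeConjectureFor m X :=
  hodgeConjectureFor_of_chowRankLEOneUpTo hX.1 (chowRankLEOneUpTo_of_isSmoothCompleteIntersection_of_ELV hR hX hd hl hsum) hm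

/-- **`HC(Y × Z)` for two smooth complete intersections in their ELV ranges (`l`, `l'`) with `dim Y ≤ 2l + 5`, `dim Z ≤ 2l' + 5`, `dim Y + dim Z ≤ 2(l + l') + 7`, granted ELV** (g33-#7 §3).
[cite: EsnaultLevineViehweg1997, Thm 4.6 (announced as Thm 4.5 in the Introduction), first bullet] [cite: VoisinHodgeII2003, Thm. 10.29 and proof of Thm. 10.31] [cite: Voisin2013GHCBloch, Lemma 2.1 (proof)]
[cite: VoisinHodgeI2002, §11.3.3 Thm. 11.38, Lemma 11.41 and p. 287] -/
theorem hodgeConjectureFor_tensor_completeIntersections_of_ELV (hR : EsnaultLevineViehweg1997_chowGroup_rank_le_one.{0}) (hY : IsSmoothCompleteIntersection m d Y)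
    (hZ : IsSmoothCompleteIntersection n d' Z) (hd : ∀ a, 2 ≤ d a) (hd' : ∀ a, 2 ≤ d' a) {l l' : ℕ} (hl : (∃ a, 3 ≤ d a) ∨ l + 1 ≤ c) (hl' : (∃ a, 3 ≤ d' a) ∨ l' + 1 ≤ c')
    (hsum : ∑ a, Nat.choose (l + d a) (l + 1) ≤ m + c) (hsum' : ∑ a, Nat.choose (l' + d' a) (l' + 1) ≤ n + c') (hm : m ≤ 2 * l + 5) (hn : n ≤ 2 * l' + 5)
    (hmn : m + n ≤ 2 * (l + l') + 7) : HodgeConjectureFor (m + n) (Y ⊗ Z) :=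
  hodgeConjectureFor_tensor_of_chowRankLEOneUpTo hY.1 hZ.1 (chowRankLEOneUpTo_of_isSmoothCompleteIntersection_of_ELV hR hY hd hl hsum)
    (chowRankLEOneUpTo_of_isSmoothCompleteIntersection_of_ELV hR hZ hd' hl' hsum') hm hn hmn

/-- **`HC(Y × Z)` for a smooth complete intersection `Y` in its ELV range `l` and ANY smooth projective `Z` of dimension `≤ 3` with `dim Y + dim Z ≤ 2l + 5`, granted ELV** (g33-#7 §3).
[cite: EsnaultLevineViehweg1997, Thm 4.6 (announced as Thm 4.5 in the Introduction), first bullet] [cite: VoisinHodgeII2003, Thm. 10.29 and proof of Thm. 10.31] [cite: Voisin2013GHCBloch, Lemma 2.1 (proof)] -/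
theorem hodgeConjectureFor_completeIntersection_tensor_of_dim_le_three_of_ELV (hR : EsnaultLevineViehweg1997_chowGroup_rank_le_one.{0}) (hY : IsSmoothCompleteIntersection m d Y)
    (hZ : IsSmoothProjective n Z) (hd : ∀ a, 2 ≤ d a) {l : ℕ} (hl : (∃ a, 3 ≤ d a) ∨ l + 1 ≤ c) (hsum : ∑ a, Nat.choose (l + d a) (l + 1) ≤ m + c) (hn : n ≤ 3)
    (hmn : m + n ≤ 2 * l + 5) : HodgeConjectureFor (m + n) (Y ⊗ Z) :=
  hodgeConjectureFor_tensor_of_chowRankLEOneUpTo_of_dim_le_three hY.1 hZ (chowRankLEOneUpTo_of_isSmoothCompleteIntersection_of_ELV hR hY hd hl hsum) hn hmn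

/-! ### §2 Cubic hypersurfaces: `HC` in every dimension `≤ 7` (cubic sixfolds!), eightfolds without the base-change bridge -/

/-- **`CH₀(X)_ℚ, CH₁(X)_ℚ` have rank `≤ 1` for a smooth cubic hypersurface of dimension `≥ 5`** («`CH₁(X) = ℚ` for `dim X ≥ 5`», Vial 2013 §7.2.2; ELV `l = 1`: `C(4,2) = 6 ≤ m + 1`), granted ELV.
[cite: Vial2013, §7.2.2] [cite: EsnaultLevineViehweg1997, Thm 4.6 (announced as Thm 4.5 in the Introduction), first bullet] -/
theorem chowRankLEOneUpTo_one_of_cubic_of_ELV (hR : EsnaultLevineViehweg1997_chowGroup_rank_le_one.{0}) (hX : IsSmoothCompleteIntersection m (fun _ : Fin 1 ↦ 3) X) (hm : 5 ≤ m) :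
    ChowRankLEOneUpTo X 1 :=
  chowRankLEOneUpTo_of_isSmoothCompleteIntersection_of_ELV hR hX (fun _ ↦ by norm_num) (Or.inl ⟨0, le_rfl⟩) (by simp [Nat.choose]; omega)

/-- **The Hodge conjecture for EVERY smooth cubic hypersurface of dimension `m ≤ 7` (cut out in `ℙ^{m+1}_ℂ` by a nonsingular cubic form), granted Esnault–Levine–Viehweg** — in particular for all smooth
cubic SIXFOLDS.  `m ≤ 3`: the tree's `hodgeConjectureFor_of_dim_le_three_holds`; `m = 4`: `CH₀` (`l = 0`, `3 ≤ 5`, `4 ≤ 5`); `5 ≤ m ≤ 7`: `CH₀, CH₁` (`l = 1`, `6 ≤ m + 1`, `m ≤ 7`).  PRINT-IMPLIED: Vial 2013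
Thm. 7.1 first item (`l = ⌊(d − 4)/2⌋ ≤ 1` for `d ≤ 7`, niveau `0`) with §7.2.2. [cite: Vial2013, Thm 7.1 (first item), proof p. 19, and §7.2.2] [cite: Laterveer1998, main theorem (as quoted in Vial2013 Thm. 7.1)]
[cite: EsnaultLevineViehweg1997, Thm 4.6 (announced as Thm 4.5 in the Introduction), first bullet] [cite: VoisinHodgeII2003, Thm. 10.29 and proof of Thm. 10.31] [cite: Voisin2013GHCBloch, Lemma 2.1 (proof)] -/
theorem hodgeConjectureFor_cubic_of_ELV (hR : EsnaultLevineViehweg1997_chowGroup_rank_le_one.{0}) (hX : IsSmoothCompleteIntersection m (fun _ : Fin 1 ↦ 3) X) (hm : m ≤ 7) :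
    HodgeConjectureFor m X := by
  rcases Nat.lt_or_ge m 4 with h3 | h4
  · exact hodgeConjectureFor_of_dim_le_three_holds (by omega) hX.1
  rcases Nat.lt_or_ge m 5 with h4' | h5
  · exact hodgeConjectureFor_completeIntersection_of_ELV hR hX (fun _ ↦ by norm_num) (l := 0) (Or.inl ⟨0, le_rfl⟩) (by simp; omega) (by omega)
  · exact hodgeConjectureFor_of_chowRankLEOneUpTo hX.1 (chowRankLEOneUpTo_one_of_cubic_of_ELV hR hX h5) (by omega)

/-- **`HC` for every smooth cubic fivefold `X ⊂ ℙ⁶_ℂ`, granted ELV** (middle cohomology `H⁵` supported in codimension `2`; even degrees Lefschetz). [cite: Vial2013, Thm 7.1 (first item) and §7.2.2]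
[cite: EsnaultLevineViehweg1997, Thm 4.6 (announced as Thm 4.5 in the Introduction), first bullet] -/
theorem hodgeConjectureFor_cubicFivefold_of_ELV (hR : EsnaultLevineViehweg1997_chowGroup_rank_le_one.{0}) (hX : IsSmoothCompleteIntersection 5 (fun _ : Fin 1 ↦ 3) X) :
    HodgeConjectureFor 5 X :=
  hodgeConjectureFor_cubic_of_ELV hR hX (by norm_num)

/-- **The Hodge conjecture for EVERY smooth cubic sixfold `X ⊂ ℙ⁷_ℂ`, granted Esnault–Levine–Viehweg**: `CH₀(X)_ℚ = CH₁(X)_ℚ = ℚ` (ELV, `C(4,2) = 6 ≤ 7`), hence `N²H⁶(X) = H⁶(X)` (generalised decomposition of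
the diagonal) and every rational `(3,3)`-class, being supported in codimension `2`, is algebraic; degrees `≠ 6` are Lefschetz.  PRINT-IMPLIED (Vial 2013 Thm. 7.1 first item at `d = 6`, `l = 1` ∘ §7.2.2);
the tree's audit `Barriers/HodgeConjecture/NormalFunctions` found no printed sentence. [cite: Vial2013, Thm 7.1 (first item), proof p. 19, and §7.2.2] [cite: Laterveer1998, main theorem (as quoted in Vial2013 Thm. 7.1)]
[cite: EsnaultLevineViehweg1997, Thm 4.6 (announced as Thm 4.5 in the Introduction), first bullet] [cite: VoisinHodgeII2003, Thm. 10.29 and proof of Thm. 10.31] [cite: Voisin2013GHCBloch, Lemma 2.1 (proof)] -/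
theorem hodgeConjectureFor_cubicSixfold_of_ELV (hR : EsnaultLevineViehweg1997_chowGroup_rank_le_one.{0}) (hX : IsSmoothCompleteIntersection 6 (fun _ : Fin 1 ↦ 3) X) :
    HodgeConjectureFor 6 X :=
  hodgeConjectureFor_cubic_of_ELV hR hX (by norm_num)

/-- **`HC` for every smooth cubic sevenfold `X ⊂ ℙ⁸_ℂ`, granted ELV** (`7 ≤ 2·1 + 5`). [cite: Vial2013, Thm 7.1 (first item) and §7.2.2] [cite: EsnaultLevineViehweg1997, Thm 4.6 (announced as Thm 4.5 in the Introduction), first bullet] -/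
theorem hodgeConjectureFor_cubicSevenfold_of_ELV (hR : EsnaultLevineViehweg1997_chowGroup_rank_le_one.{0}) (hX : IsSmoothCompleteIntersection 7 (fun _ : Fin 1 ↦ 3) X) :
    HodgeConjectureFor 7 X :=
  hodgeConjectureFor_cubic_of_ELV hR hX (by norm_num)

/-- **Cubic eightfolds, bridge-free**: `HC(X)` for a smooth complete intersection `X` of multidegree `![3]` in `ℙ⁹_ℂ` granted ONLY the Chow input `hCH` of the tree's `hodgeConjectureFor_cubicEightfoldCI_of_chow`
(«`CH_i ⊗ ℚ` of rank `≤ 1` for `i ≤ 2` on smooth cubic eightfolds over algebraically closed fields of characteristic `0`»), used at `k = ℂ` alone — the base-change hypothesis `hbc` of that theorem is not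
needed on the cycle-level road (`Motives.ChowRankLEOneUpTo X 2`, `8 ≤ 2·2 + 5`). [cite: Vial2013, Thm 7.1 (first item) and §7.2.2] [cite: HirschowitzIyer2010, Thm. 1.5 at (9,2,1,(3)); §1.7] [cite: Otwinowska1999, Théorème] -/
theorem hodgeConjectureFor_cubicEightfoldCI_of_chow'
    (hCH : ∀ ⦃k : Type⦄ [Field k] [IsAlgClosed k] [CharZero k] ⦃Y : SchemeOver k⦄, IsSmoothCompleteIntersection 8 ![3] Y → ∀ ⦃i : ℕ⦄, i ≤ 2 →
      ∀ x y : ChowGroup Y.left i, ∃ p q : ℤ, (p ≠ 0 ∨ q ≠ 0) ∧ p • x = q • y)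
    (hX : IsSmoothCompleteIntersection 8 ![3] X) : HodgeConjectureFor 8 X :=
  hodgeConjectureFor_of_forall_chowGroup_rank_le_one hX.1 (k₀ := 2) (fun _ hj a b ↦ hCH hX hj a b) (by norm_num)

/-- **The Hodge conjecture for EVERY smooth cubic eightfold `X ⊂ ℙ⁹_ℂ` (multidegree `![3]`), granted the two typed Chow facts and nothing else**: `CH₀, CH₁` by Esnault–Levine–Viehweg, `CH₂` by
Hirschowitz–Iyer / Otwinowska (the tree's `Motives.chowGroup_rank_le_one_of_le_two_cubicEightfold`), then Laterveer / Vial at `d = 8`, `l = 2`, over `ℂ`. [cite: Vial2013, Thm 7.1 (first item) and §7.2.2]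
[cite: HirschowitzIyer2010, Thm. 1.5 at (9,2,1,(3)); §1.7] [cite: Otwinowska1999, Théorème] [cite: EsnaultLevineViehweg1997, Thm 4.6 (announced as Thm 4.5 in the Introduction), first bullet] -/
theorem hodgeConjectureFor_cubicEightfoldCI_of_hirschowitzIyer_of_ELV (h : HirschowitzIyer2010_chowTwo_rank_le_one_cubicEightfold.{0})
    (hR : EsnaultLevineViehweg1997_chowGroup_rank_le_one.{0}) (hX : IsSmoothCompleteIntersection 8 ![3] X) : HodgeConjectureFor 8 X :=
  hodgeConjectureFor_cubicEightfoldCI_of_chow' (fun _ _ _ _ _ hY _ hi x y ↦ chowGroup_rank_le_one_of_le_two_cubicEightfold h hR hY hi x y) hX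

/-! ### §3 Complete intersections of quadrics -/

/-- **`HC` for every smooth complete intersection of TWO quadrics of dimension `m ≤ 7`, granted ELV** (`m ≤ 3` free; `4 ≤ m`: `CH₀, CH₁` of rank `≤ 1` by ELV with `l = 1 ≤ c − 1`, `2·C(3,2) = 6 ≤ m + 2`;
«if `dim X ≥ 4`, then `CH₁(X) = ℚ`», Vial 2013 §7.2.3). [cite: Vial2013, Thm 7.1 (first item) and §7.2.3] [cite: EsnaultLevineViehweg1997, Thm 4.6 (announced as Thm 4.5 in the Introduction)]
[cite: Laterveer1998, main theorem (as quoted in Vial2013 Thm. 7.1)] -/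
theorem hodgeConjectureFor_twoQuadrics_of_ELV (hR : EsnaultLevineViehweg1997_chowGroup_rank_le_one.{0}) (hX : IsSmoothCompleteIntersection m (fun _ : Fin 2 ↦ 2) X) (hm : m ≤ 7) :
    HodgeConjectureFor m X := by
  rcases Nat.lt_or_ge m 4 with h3 | h4
  · exact hodgeConjectureFor_of_dim_le_three_holds (by omega) hX.1
  · exact hodgeConjectureFor_completeIntersection_of_ELV hR hX (fun _ ↦ le_rfl) (l := 1) (Or.inr le_rfl) (by simp [Nat.choose]; omega) (by omega)

/-- **`HC` for every smooth complete intersection of THREE quadrics of dimension `m ≤ 9`, `m ≠ 8`, granted ELV** (`m ≤ 3` free; `l = 0`: `6 ≤ m + 3`, `m ≤ 5`; `l = 1`: `9 ≤ m + 3`, `m ≤ 7`; `l = 2`: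
`12 ≤ m + 3`, `m ≤ 9`; the octic eightfold `(2,2,2)⁸ ⊂ ℙ¹¹` needs `CH₂` — Otwinowska, the tree's `hodgeConjectureFor_threeQuadrics_of_chow`). [cite: Vial2013, Thm 7.1 (first item)]
[cite: EsnaultLevineViehweg1997, Thm 4.6 (announced as Thm 4.5 in the Introduction)] [cite: Laterveer1998, main theorem (as quoted in Vial2013 Thm. 7.1)] -/
theorem hodgeConjectureFor_threeQuadrics_of_ELV (hR : EsnaultLevineViehweg1997_chowGroup_rank_le_one.{0}) (hX : IsSmoothCompleteIntersection m (fun _ : Fin 3 ↦ 2) X) (hm : m ≤ 9)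
    (hm8 : m ≠ 8) : HodgeConjectureFor m X := by
  rcases Nat.lt_or_ge m 4 with h3 | h4
  · exact hodgeConjectureFor_of_dim_le_three_holds (by omega) hX.1
  rcases Nat.lt_or_ge m 6 with h5 | h6
  · exact hodgeConjectureFor_completeIntersection_of_ELV hR hX (fun _ ↦ le_rfl) (l := 0) (Or.inr (by norm_num)) (by simp; omega) (by omega)
  rcases Nat.lt_or_ge m 8 with h7 | h8
  · exact hodgeConjectureFor_completeIntersection_of_ELV hR hX (fun _ ↦ le_rfl) (l := 1) (Or.inr (by norm_num)) (by simp [Nat.choose]; omega) (by omega)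
  · obtain rfl : m = 9 := by omega
    exact hodgeConjectureFor_completeIntersection_of_ELV hR hX (fun _ ↦ le_rfl) (l := 2) (Or.inr (by norm_num)) (by simp [Nat.choose]) (by norm_num)

/-- **Complete intersections of `c ≤ 4` quadrics, bridge-free Otwinowska form**: `HC(X)` for a smooth complete intersection of `c ≤ 4` quadrics of ANY dimension `m`, granted ONLY the Chow input `hCH`
of the tree's `hodgeConjectureFor_ciQuadrics_of_chow` (Otwinowska 1999: `CH_l ⊗ ℚ` of rank `≤ 1` for `2l + c ≤ m`), used at `k = ℂ` — neither the base-change bridge `hbc` nor `c ≤ m` of that theorem is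
needed (`k₀ = ⌊(m − c)/2⌋`, `m ≤ 2k₀ + 5` iff `c ≤ 4` or (`c = 5`, `m − c` even); `m ≤ 3` is free). [cite: Otwinowska1999b, Théorème (1)] [cite: Vial2013, Thm 7.1 (first item)]
[cite: Laterveer1998, main theorem (as quoted in Vial2013 Thm. 7.1)] -/
theorem hodgeConjectureFor_ciQuadrics_of_chow'
    (hCH : ∀ ⦃k : Type⦄ [Field k] [IsAlgClosed k] [CharZero k] ⦃m c : ℕ⦄ ⦃Y : SchemeOver k⦄, IsSmoothCompleteIntersection m (fun _ : Fin c ↦ 2) Y → ∀ ⦃l : ℕ⦄, 2 * l + c ≤ m →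
      ∀ x y : ChowGroup Y.left l, ∃ p q : ℤ, (p ≠ 0 ∨ q ≠ 0) ∧ p • x = q • y)
    (hc : c ≤ 4) (hX : IsSmoothCompleteIntersection m (fun _ : Fin c ↦ 2) X) : HodgeConjectureFor m X := by
  rcases Nat.lt_or_ge m 4 with h3 | h4
  · exact hodgeConjectureFor_of_dim_le_three_holds (by omega) hX.1
  · exact hodgeConjectureFor_of_forall_chowGroup_rank_le_one hX.1 (k₀ := (m - c) / 2) (fun j hj a b ↦ hCH hX (by omega) a b) (by omega)

/-! ### §4 Products granted ELV -/

/-- **`HC(X × C)` for every smooth cubic sixfold `X ⊂ ℙ⁷_ℂ` and every smooth projective curve `C`, granted ELV** (`6 + 1 ≤ 2·1 + 5`). [cite: EsnaultLevineViehweg1997, Thm 4.6 (announced as Thm 4.5 in the Introduction), first bullet]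
[cite: VoisinHodgeII2003, Thm. 10.29 and proof of Thm. 10.31] [cite: Voisin2013GHCBloch, Lemma 2.1 (proof)] -/
theorem hodgeConjectureFor_cubicSixfold_tensor_curve_of_ELV (hR : EsnaultLevineViehweg1997_chowGroup_rank_le_one.{0}) (hX : IsSmoothCompleteIntersection 6 (fun _ : Fin 1 ↦ 3) X)
    (hC : IsSmoothProjective 1 C) : HodgeConjectureFor (6 + 1) (X ⊗ C) :=
  hodgeConjectureFor_sixfold_tensor_curve_of_chowRankLEOneUpTo_one hX.1 hC (chowRankLEOneUpTo_one_of_cubic_of_ELV hR hX (by norm_num))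

/-- **`HC(X × T)` for a smooth cubic sixfold `X ⊂ ℙ⁷_ℂ` and a smooth projective threefold `T` with `CH₀(T)` of rank `≤ 1`, granted ELV.** [cite: EsnaultLevineViehweg1997, Thm 4.6 (announced as Thm 4.5 in the Introduction), first bullet]
[cite: VoisinHodgeII2003, Thm. 10.29, proof of Thm. 10.31 and §10.2.2 Thm. 10.17] [cite: BlochSrinivas1983, Thm. 1] [cite: Voisin2013GHCBloch, Lemma 2.1 (proof)] -/
theorem hodgeConjectureFor_cubicSixfold_tensor_threefold_of_ELV_of_chowRankLEOneUpTo_zero (hR : EsnaultLevineViehweg1997_chowGroup_rank_le_one.{0})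
    (hX : IsSmoothCompleteIntersection 6 (fun _ : Fin 1 ↦ 3) X) (hT : IsSmoothProjective 3 T) (hCHT : ChowRankLEOneUpTo T 0) : HodgeConjectureFor (6 + 3) (X ⊗ T) :=
  hodgeConjectureFor_sixfold_tensor_threefold_of_chowRankLEOneUpTo_one_zero hX.1 hT (chowRankLEOneUpTo_one_of_cubic_of_ELV hR hX (by norm_num)) hCHT

/-- **`HC(X × X')` for a smooth cubic sixfold `X ⊂ ℙ⁷_ℂ` and ANY smooth projective fivefold `X'` with `CH₀, CH₁` of rank `≤ 1`, granted ELV** (`6 ≤ 7`, `5 ≤ 7`, `11 ≤ 2(1 + 1) + 7`).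
[cite: EsnaultLevineViehweg1997, Thm 4.6 (announced as Thm 4.5 in the Introduction), first bullet] [cite: VoisinHodgeII2003, Thm. 10.29 and proof of Thm. 10.31] [cite: Voisin2013GHCBloch, Lemma 2.1 (proof)]
[cite: VoisinHodgeI2002, §11.3.3 Thm. 11.38, Lemma 11.41 and p. 287] -/
theorem hodgeConjectureFor_cubicSixfold_tensor_fivefold_of_ELV_of_chowRankLEOneUpTo_one (hR : EsnaultLevineViehweg1997_chowGroup_rank_le_one.{0})
    (hX : IsSmoothCompleteIntersection 6 (fun _ : Fin 1 ↦ 3) X) (hX' : IsSmoothProjective 5 Y) (hCH' : ChowRankLEOneUpTo Y 1) : HodgeConjectureFor (6 + 5) (X ⊗ Y) :=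
  hodgeConjectureFor_tensor_of_chowRankLEOneUpTo hX.1 hX' (chowRankLEOneUpTo_one_of_cubic_of_ELV hR hX (by norm_num)) hCH' (by norm_num) (by norm_num) (by norm_num)

/-- **`HC(X × X')` for a smooth cubic SIXFOLD `X ⊂ ℙ⁷_ℂ` and a smooth cubic FIVEFOLD `X' ⊂ ℙ⁶_ℂ`, granted ELV.** [cite: EsnaultLevineViehweg1997, Thm 4.6 (announced as Thm 4.5 in the Introduction), first bullet]
[cite: VoisinHodgeII2003, Thm. 10.29 and proof of Thm. 10.31] [cite: Voisin2013GHCBloch, Lemma 2.1 (proof)] -/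
theorem hodgeConjectureFor_cubicSixfold_tensor_cubicFivefold_of_ELV (hR : EsnaultLevineViehweg1997_chowGroup_rank_le_one.{0}) (hX : IsSmoothCompleteIntersection 6 (fun _ : Fin 1 ↦ 3) X)
    (hX' : IsSmoothCompleteIntersection 5 (fun _ : Fin 1 ↦ 3) Y) : HodgeConjectureFor (6 + 5) (X ⊗ Y) :=
  hodgeConjectureFor_cubicSixfold_tensor_fivefold_of_ELV_of_chowRankLEOneUpTo_one hR hX hX'.1 (chowRankLEOneUpTo_one_of_cubic_of_ELV hR hX' (by norm_num))

/-- **`HC(Y × T)` for a smooth complete intersection of two quadrics `Y` of dimension `4` and EVERY smooth projective threefold `T`, granted ELV** (`CH₀, CH₁(Y)` of rank `≤ 1`; `4 + 3 ≤ 2·1 + 5`).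
[cite: Vial2013, §7.2.3] [cite: EsnaultLevineViehweg1997, Thm 4.6 (announced as Thm 4.5 in the Introduction)] [cite: VoisinHodgeII2003, Thm. 10.29 and proof of Thm. 10.31] [cite: Voisin2013GHCBloch, Lemma 2.1 (proof)] -/
theorem hodgeConjectureFor_twoQuadricsFourfold_tensor_threefold_of_ELV (hR : EsnaultLevineViehweg1997_chowGroup_rank_le_one.{0}) (hY : IsSmoothCompleteIntersection 4 (fun _ : Fin 2 ↦ 2) Y)
    (hT : IsSmoothProjective 3 T) : HodgeConjectureFor (4 + 3) (Y ⊗ T) :=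
  hodgeConjectureFor_completeIntersection_tensor_of_dim_le_three_of_ELV hR hY hT (fun _ ↦ le_rfl) (l := 1) (Or.inr le_rfl) (by simp [Nat.choose]) le_rfl (by norm_num)

/-- **`HC(Y × S)` for a smooth complete intersection of two quadrics `Y` of dimension `5` and every smooth projective surface `S`, granted ELV** (`5 + 2 ≤ 7`). [cite: Vial2013, §7.2.3]
[cite: EsnaultLevineViehweg1997, Thm 4.6 (announced as Thm 4.5 in the Introduction)] [cite: VoisinHodgeII2003, Thm. 10.29 and proof of Thm. 10.31] [cite: Voisin2013GHCBloch, Lemma 2.1 (proof)] -/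
theorem hodgeConjectureFor_twoQuadricsFivefold_tensor_surface_of_ELV (hR : EsnaultLevineViehweg1997_chowGroup_rank_le_one.{0}) (hY : IsSmoothCompleteIntersection 5 (fun _ : Fin 2 ↦ 2) Y)
    (hS : IsSmoothProjective 2 S) : HodgeConjectureFor (5 + 2) (Y ⊗ S) :=
  hodgeConjectureFor_completeIntersection_tensor_of_dim_le_three_of_ELV hR hY hS (fun _ ↦ le_rfl) (l := 1) (Or.inr le_rfl) (by simp [Nat.choose]) (by norm_num) (by norm_num)

end Literature.AlgebraicGeometry.HodgeTheory

end
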